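import Summits.BirchSwinnertonDyer.BirchSwinnertonDyer.Theorems.SmallImageMuTransferAnalyticMuZeroX9TeichSpanOrbitHecke
import Summits.BirchSwinnertonDyer.BirchSwinnertonDyer.Theorems.SmallImageMuTransferAnalyticMuZeroX9TeichSpanDefs
import HarnessLib

/-!
# LINE C `teichSpan-x9` (crux 19630 `SmallImageMuTransfer.AnalyticMuZeroX9`), stub 2 — part 2/3:
# the `p`-adic recursion, Teichmüller packets ↦ orbit sums, units in fibres

Cell `bsd-f3-mu`, seat `p1` (gen 5), `--supports stmt-BirchSwinnertonDyer-19630` (helper).  Theorems only.  Part 2 of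
the proof of the registered stub 2 of LINE C (skeleton `teichSpan_x9.lean` 7a5ad0a1c1f02cfe); namespace
`Summit.BirchSwinnertonDyer.BirchSwinnertonDyer.Cruxes.AnalyticMuZeroX9.TeichSpan` (vocabulary: `…TeichSpanDefs.lean`,
p586637 = skeleton §0 verbatim).
* §C `norm_add_lt_one_of_recursion` — the three-case recursion in `ℚ_p`: from `A·X_{m+1} ≡ X_m`, `A·X_0 ≡ −s₀`,
  `X_0 = (A−2)s₀` (all integral) conclude `X_m ≡ −s₀` for all `m` (`A ≡ 1`: upward induction; else
  `(A−1)²s₀ ≡ 0 ⟹ s₀ ≡ 0`, then `A ≡ 0` downward / `A` a unit upward) — the skeleton docstring's cases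
  `[0]⁺ ≡ 0 / a_p ≡ 1 / a_p ≡ 0`.
* §D `exists_sum_packet_eq_teichOrbitSum` — a Teichmüller PACKET `l` at level `n ≥ 1` (`IsTeichPacket N p n l`:
  `p − 1` elements of `Γ₀(N)` with `d = pⁿ`, `b`-entries distinct mod `pⁿ` with a common `(p−1)`-th power) has
  `Σ_{g∈l} [b_g/pⁿ]⁺_f = S_f(p,n,u)` for a unit `u` (the residues ARE a Teichmüller coset: units by `ad − bc = 1`,
  inside `u·{t^{p−1}=1}`, and both sets have `p − 1` elements); `isUnit_of_castHom_eq` (lifts of units are units),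
  `card_filter_castHom_eq` (a fibre of `ℤ/p^{n+2} → ℤ/p^{n+1}` has `p` elements).
HONEST FRAMING: nothing about any curve is asserted; beyond-print theorem: no.
References: [MazurTateTeitelbaum1986Invent] §I.10 (10.1); [Manin1972] Prop. 1.4; [Washington1997] §5.1.
-/

-- the summit namespace repeats `BirchSwinnertonDyer` by design (summit = problem); linter moot
set_option linter.dupNamespace false
set_option autoImplicit false

noncomputable section

open scoped Classical MatrixGroups ModularForm
open CongruenceSubgroup
open Literature.NumberTheory.EllipticCurves.Rank1Residual

namespace Summit.BirchSwinnertonDyer.BirchSwinnertonDyer.Cruxes.AnalyticMuZeroX9.TeichSpan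

open Matrix Matrix.SpecialLinearGroup
  Literature.NumberTheory.EllipticCurves Literature.NumberTheory.EllipticCurves.ModularForms
  Summit.BirchSwinnertonDyer.BirchSwinnertonDyer.Theorems.CollapseThree

/-! ### §C The `p`-adic recursion: constant orbit sums are `≡ −[0]⁺` at every level -/

section Recursion

variable {p : ℕ} [Fact p.Prime]

/-- **The three-case recursion.** In `ℚ_p`, let `A = a_p`, `s₀ = [0]⁺`, `X_m = c_{m+1}` (the common value mod `p`
of the orbit sums at level `m + 1`), all of norm `≤ 1`, with `A·X_{m+1} ≡ X_m`, `A·X_0 ≡ −s₀` and `X_0 = (A − 2)s₀`.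
Then `X_m ≡ −s₀` for every `m`: if `A ≡ 1` by induction upward; otherwise `(A−1)²s₀ ≡ 0` forces `s₀ ≡ 0`,
`X_0 ≡ 0`, and then `X_m ≡ 0` downward (`A ≡ 0`) or upward (`A` a unit). [folklore] -/
theorem norm_add_lt_one_of_recursion {A s₀ : ℚ_[p]} {X : ℕ → ℚ_[p]} (hA : ‖A‖ ≤ 1)
    (hX : ∀ m, ‖X m‖ ≤ 1) (hrec : ∀ m, ‖A * X (m + 1) - X m‖ < 1) (hzero : ‖A * X 0 + s₀‖ < 1)
    (hX0 : X 0 = (A - 2) * s₀) (m : ℕ) : ‖X m + s₀‖ < 1 := by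
  by_cases h1 : ‖A - 1‖ < 1
  · -- `A ≡ 1`: `A y ≡ y` for integral `y`
    have hAy : ∀ y : ℚ_[p], ‖y‖ ≤ 1 → ‖A * y - y‖ < 1 := fun y hy ↦ by
      rw [show A * y - y = (A - 1) * y by ring, mul_comm]
      exact padic_norm_mul_lt_one hy h1
    induction m with
    | zero =>
      rw [show X 0 + s₀ = (A * X 0 + s₀) - (A * X 0 - X 0) by ring]
      exact norm_sub_lt_one hzero (hAy _ (hX 0))
    | succ m ih =>
      rw [show X (m + 1) + s₀ = (X m + s₀) + (A * X (m + 1) - X m) - (A * X (m + 1) - X (m + 1)) by ring]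
      exact norm_sub_lt_one (padic_norm_add_lt_one ih (hrec m)) (hAy _ (hX _))
  · -- `A ≢ 1`: then `‖A − 1‖ = 1`, `s₀ ≡ 0`, `X_0 ≡ 0`
    have hA1' : ‖A - 1‖ ≤ 1 := by
      rw [sub_eq_add_neg]
      exact (Padic.nonarchimedean A (-1)).trans (max_le hA (by rw [norm_neg, norm_one]))
    have hA1 : ‖A - 1‖ = 1 := le_antisymm hA1' (not_lt.mp h1)
    have hs : ‖s₀‖ < 1 := by
      have h : ‖(A - 1) ^ 2 * s₀‖ < 1 := by
        rw [show (A - 1) ^ 2 * s₀ = A * X 0 + s₀ by rw [hX0]; ring]; exact hzero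
      rwa [norm_mul, norm_pow, hA1, one_pow, one_mul] at h
    have h2 : ‖(2 : ℚ_[p])‖ ≤ 1 := by exact_mod_cast Padic.norm_int_le_one (p := p) 2
    have hA2 : ‖A - 2‖ ≤ 1 := by
      rw [sub_eq_add_neg]
      exact (Padic.nonarchimedean A (-2)).trans (max_le hA (by rwa [norm_neg]))
    have hX0' : ‖X 0‖ < 1 := by rw [hX0]; exact padic_norm_mul_lt_one hA2 hs
    suffices hXm : ∀ m, ‖X m‖ < 1 from padic_norm_add_lt_one (hXm m) hs
    intro m
    by_cases hA0 : ‖A‖ < 1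
    · -- `A ≡ 0`: `X_m ≡ A X_{m+1} ≡ 0`
      rw [show X m = A * X (m + 1) - (A * X (m + 1) - X m) by ring]
      exact norm_sub_lt_one (by rw [mul_comm]; exact padic_norm_mul_lt_one (hX _) hA0) (hrec m)
    · -- `A` a unit: upward induction
      have hAu : ‖A‖ = 1 := le_antisymm hA (not_lt.mp hA0)
      induction m with
      | zero => exact hX0'
      | succ m ih =>
        have h : ‖A * X (m + 1)‖ < 1 := by
          rw [show A * X (m + 1) = (A * X (m + 1) - X m) + X m by ring]
          exact padic_norm_add_lt_one (hrec m) ih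
        rwa [norm_mul, hAu, one_mul] at h

end Recursion

/-! ### §D Teichmüller packets ↦ orbit sums; lifts of units are units -/

section Packets

variable {N : ℕ} [NeZero N] {f : CuspForm (Gamma0 N) 2} {p : ℕ} [Fact p.Prime]

omit [NeZero N] [Fact p.Prime] in
/-- The `b`-entry of an element of `Γ₀(N)` with `d = pⁿ` is a unit mod `pⁿ` (`ad − bc = 1`). [folklore] -/
theorem isUnit_bEntry_of_dEntry_eq {n : ℕ} {g : Gamma0 N} (hd : dEntry g = (p : ℤ) ^ n) :
    IsUnit (((bEntry g : ℤ)) : ZMod (p ^ n)) := by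
  have hdet : ((g : SL(2, ℤ)) 0 0 : ℤ) * (g : SL(2, ℤ)) 1 1 - (g : SL(2, ℤ)) 0 1 * (g : SL(2, ℤ)) 1 0 = 1 := by
    have := Matrix.SpecialLinearGroup.det_coe (g : SL(2, ℤ))
    rwa [Matrix.det_fin_two] at this
  have hd' : ((g : SL(2, ℤ)) 1 1 : ℤ) = (p : ℤ) ^ n := hd
  rw [hd'] at hdet
  have hpn : (((p : ℤ) ^ n : ℤ) : ZMod (p ^ n)) = 0 := by
    rw [Int.cast_pow, Int.cast_natCast, ← Nat.cast_pow, ZMod.natCast_self]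
  have h : (((bEntry g : ℤ)) : ZMod (p ^ n)) * (((-(g : SL(2, ℤ)) 1 0 : ℤ)) : ZMod (p ^ n)) = 1 := by
    have := congr_arg (Int.cast : ℤ → ZMod (p ^ n)) hdet
    push_cast at this hpn ⊢
    rw [hpn] at this
    simp only [bEntry]
    linear_combination this
  exact IsUnit.of_mul_eq_one _ h

/-- **A Teichmüller packet sums to an orbit sum**: if `l` is a packet at level `n ≥ 1` (the cusps `b_g/pⁿ`, `g ∈ l`,
run once through a Teichmüller coset), then `Σ_{g ∈ l} [b_g/pⁿ]⁺_f = S_f(p, n, u)` for the unit `u = b_{g₀} mod pⁿ`.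
[cite: MazurTateTeitelbaum1986Invent, §I.10 (10.1)] [cite: Washington1997, §5.1 (Teichmüller character ω)] -/
theorem exists_sum_packet_eq_teichOrbitSum (hp2 : p ≠ 2) {n : ℕ} (hn : 1 ≤ n) {l : List (Gamma0 N)}
    (hl : IsTeichPacket N p n l) :
    ∃ u : (ZMod (p ^ n))ˣ, (l.map fun g ↦ ratPlusSymbol f (((bEntry g : ℤ) : ℚ) / (p : ℚ) ^ n)).sum =
      teichOrbitSum f p n (u : ZMod (p ^ n)) := by
  classical
  have hp : p.Prime := Fact.out
  haveI := neZero_torsionOrder p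
  haveI := Fintype.ofFinite (rootsOfUnity (torsionOrder p) ℤ_[p])
  haveI : NeZero (p ^ n) := ⟨pow_ne_zero _ hp.ne_zero⟩
  obtain ⟨hlen, hd, hnodup, c, hc⟩ := hl
  have hne : l ≠ [] := by
    intro h; rw [h, List.length_nil] at hlen; have := hp.two_le; omega
  obtain ⟨g₀, hg₀⟩ := List.exists_mem_of_ne_nil l hne
  have hu₀ : IsUnit (((bEntry g₀ : ℤ)) : ZMod (p ^ n)) := isUnit_bEntry_of_dEntry_eq (hd g₀ hg₀)
  set u := hu₀.unit with hu
  refine ⟨u, ?_⟩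
  have huval : (u : ZMod (p ^ n)) = ((bEntry g₀ : ℤ) : ZMod (p ^ n)) := hu₀.unit_spec
  -- the list of residues and the Teichmüller set
  set B : List (ZMod (p ^ n)) := l.map fun g ↦ ((bEntry g : ℤ) : ZMod (p ^ n)) with hB
  set F : Finset (ZMod (p ^ n)) := Finset.univ.filter (fun t : ZMod (p ^ n) ↦ t ^ (p - 1) = 1) with hF
  have hFcard : F.card = p - 1 := by
    rw [hF, ← image_toZModPow_rootsOfUnity_eq_filter p hp2 hn,
      Finset.card_image_of_injective _ (toZModPow_rootsOfUnity_injective_of_le p hp2 hn),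
      Finset.card_univ, card_rootsOfUnity_eq hp2]
  have hcu : c = (u : ZMod (p ^ n)) ^ (p - 1) := by rw [huval, hc g₀ hg₀]
  -- `B.toFinset = F · u`
  have hBF : B.toFinset = F.image (fun t ↦ t * (u : ZMod (p ^ n))) := by
    apply Finset.eq_of_subset_of_card_le
    · intro x hx
      rw [List.mem_toFinset, hB, List.mem_map] at hx
      obtain ⟨g, hg, rfl⟩ := hx
      rw [Finset.mem_image]
      refine ⟨((bEntry g : ℤ) : ZMod (p ^ n)) * ((u⁻¹ : (ZMod (p ^ n))ˣ) : ZMod (p ^ n)), ?_, ?_⟩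
      · rw [hF, Finset.mem_filter]
        refine ⟨Finset.mem_univ _, ?_⟩
        rw [mul_pow, hc g hg, hcu, ← Units.val_pow_eq_pow_val, ← Units.val_pow_eq_pow_val, ← Units.val_mul,
          inv_pow, mul_inv_cancel, Units.val_one]
      · rw [mul_assoc, Units.inv_mul, mul_one]
    · rw [List.toFinset_card_of_nodup hnodup, hB, List.length_map, hlen]
      exact Finset.card_image_le.trans hFcard.le
  -- the sums
  have h1 : (l.map fun g ↦ ratPlusSymbol f (((bEntry g : ℤ) : ℚ) / (p : ℚ) ^ n)) =
      B.map fun x ↦ ratPlusSymbol f ((x.val : ℚ) / (p : ℚ) ^ n) := by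
    rw [hB, List.map_map]
    refine List.map_congr_left fun g _ ↦ ?_
    simp only [Function.comp_apply]
    exact ratPlusSymbol_intCast_div_pow (f := f) (p := p) n (bEntry g)
  rw [h1, ← List.sum_toFinset _ hnodup, hBF, Finset.sum_image, teichOrbitSum_def]
  intro t _ t' _ h
  exact (Units.mul_left_inj u).mp h

/-- In `ℤ/pⁿ`, `n ≥ 1`, `x` is a unit iff `p ∤ x.val`. [folklore] -/
theorem isUnit_iff_not_dvd_val {n : ℕ} (hn : 1 ≤ n) (x : ZMod (p ^ n)) : IsUnit x ↔ ¬ p ∣ x.val := by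
  haveI : NeZero (p ^ n) := ⟨pow_ne_zero _ (Fact.out : p.Prime).ne_zero⟩
  conv_lhs => rw [← ZMod.natCast_zmod_val x]
  exact ZMod.isUnit_natCast_iff_not_dvd_pow Fact.out (by omega)

/-- A lift to `ℤ/p^{n+2}` of a unit of `ℤ/p^{n+1}` is a unit. [folklore] -/
theorem isUnit_of_castHom_eq {n : ℕ} {a : ZMod (p ^ (n + 1))} (ha : IsUnit a) {b : ZMod (p ^ (n + 2))}
    (hb : ZMod.castHom (pow_dvd_pow p (n + 1).le_succ) (ZMod (p ^ (n + 1))) b = a) : IsUnit b := by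
  have hp : p.Prime := Fact.out
  haveI : NeZero (p ^ (n + 1)) := ⟨pow_ne_zero _ hp.ne_zero⟩
  haveI : NeZero (p ^ (n + 2)) := ⟨pow_ne_zero _ hp.ne_zero⟩
  rw [isUnit_iff_not_dvd_val (by omega)] at ha ⊢
  have hval : a.val = b.val % p ^ (n + 1) := by
    rw [← hb, ZMod.castHom_apply, ZMod.cast_eq_val, ZMod.val_natCast]
  intro hdvd
  apply ha
  rw [hval]
  have hpp : p ∣ p ^ (n + 1) := dvd_pow_self p (by omega)
  exact (Nat.dvd_mod_iff hpp).mpr hdvd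

/-- The fibre of `a ∈ ℤ/p^{n+1}` in `ℤ/p^{n+2}` has exactly `p` elements. [folklore] -/
theorem card_filter_castHom_eq (n : ℕ) (a : ZMod (p ^ (n + 1))) :
    (Finset.univ.filter (fun b : ZMod (p ^ (n + 2)) ↦
      ZMod.castHom (pow_dvd_pow p (n + 1).le_succ) (ZMod (p ^ (n + 1))) b = a)).card = p := by
  classical
  have hp : p.Prime := Fact.out
  haveI : NeZero (p ^ (n + 1)) := ⟨pow_ne_zero _ hp.ne_zero⟩
  rw [filter_castHom_eq_image (n + 1) a, Finset.card_image_of_injective, Finset.card_univ, Fintype.card_fin]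
  intro j j' hjj'
  have hlt : ∀ i : Fin p, a.val + p ^ (n + 1) * (i : ℕ) < p ^ (n + 2) := by
    intro i
    have h1 : a.val < p ^ (n + 1) := ZMod.val_lt _
    have h2 : (i : ℕ) ≤ p - 1 := Nat.le_sub_one_of_lt i.isLt
    have h3 : p ^ (n + 1) + p ^ (n + 1) * (p - 1) = p ^ (n + 2) := by
      have h4 : p ^ (n + 1) * (p - 1) + p ^ (n + 1) * 1 = p ^ (n + 1) * p := by
        rw [← Nat.mul_add, Nat.sub_add_cancel hp.one_le]
      rw [pow_succ p (n + 1)]; omega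
    calc a.val + p ^ (n + 1) * (i : ℕ) < p ^ (n + 1) + p ^ (n + 1) * (p - 1) := by
          have := Nat.mul_le_mul_left (p ^ (n + 1)) h2; omega
      _ = p ^ (n + 2) := h3
  have h := congr_arg ZMod.val hjj'
  simp only at h
  rw [ZMod.val_natCast_of_lt (hlt j), ZMod.val_natCast_of_lt (hlt j')] at h
  have hp0 : 0 < p ^ (n + 1) := pow_pos hp.pos _
  exact Fin.ext (Nat.eq_of_mul_eq_mul_left hp0 (by omega))

end Packets

end Summit.BirchSwinnertonDyer.BirchSwinnertonDyer.Cruxes.AnalyticMuZeroX9.TeichSpan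

end
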